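import Mathlib
import Summits.Ventures.PercRepro2.HCov
import Summits.Ventures.PercRepro2.GcSkelRules
import Summits.Ventures.PercRepro2.GcSkelReductionT
import Summits.Ventures.PercRepro2.GcSkelShapeT
import Summits.Ventures.PercRepro2.GcSkelReductionMin
import Summits.Ventures.PercRepro2.GcSkelShapeZ
import Summits.Ventures.PercRepro2.GcHatConn
import Summits.Ventures.PercRepro2.GcSkelReductionHat
import Summits.Ventures.PercRepro2.GcSkelShapeHat
import Summits.Ventures.PercRepro2.GcBundleConn
import Summits.Ventures.PercRepro2.GcBundle
import Summits.Ventures.PercRepro2.GcSkelReductionBundle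

/-!
# The root-bundle clause read at a pair of unmarked vertices (blind cell PercRepro2, typer-1 g57)

Two unmarked vertices `x, y` whose non-loop edges all go to `x, y`, the roots and one further
vertex `v` form the bundle `W = {x, y}` (`hasBundle_of_pair`), so on the class of record

* **`exists_two_outer_nbrs_of_pair`** — for any two distinct unmarked vertices `x ≠ y` with `x`
  active, the non-loop edges at `x` or `y` reach two DISTINCT vertices outside `{x, y, a₁, a₂}`.

On seven vertices (`shape_of_wredMinHAZB`: the five marks and two active unmarked vertices
`x, y`) this says that `x` and `y` together see at least two of `{o, b, a₃}` — with
`exists_two_nonroot_nbrs_of_wredMinHAZB` (each of `x, y` sees two of `{o, b, a₃}` and the other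
unmarked vertex) the neighbourhood constraints of the smallest members of the class of record.
Standard axioms.
-/

namespace Summit.Ventures.PercRepro2

open CovForm RECM

namespace WRed

section Pair

variable {V : Type*} {E : Type*} [Fintype E] [DecidableEq E] [DecidableEq V]

omit [DecidableEq E] in
/-- **Two unmarked vertices whose non-loop edges all go to themselves, the roots and one further
vertex form a bundle**: `W = {x, y}` with terminals `a₁, a₂, v`, as soon as `x` has at least three
non-loop edges. -/
lemma hasBundle_of_pair {ends : E → Sym2 V} {o a₁ a₂ a₃ b x y v : V}
    (hx : Unmarked o a₁ a₂ a₃ b x) (hy : Unmarked o a₁ a₂ a₃ b y) (hvx : v ≠ x) (hvy : v ≠ y)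
    (hv1 : v ≠ a₁) (hv2 : v ≠ a₂)
    (hP : ∀ e, e ∈ edgesAt ends x ∨ e ∈ edgesAt ends y → ∀ z w, ends e = s(z, w) →
      (z = x ∨ z = y) → w = x ∨ w = y ∨ w = a₁ ∨ w = a₂ ∨ w = v)
    (hdeg : 3 ≤ nonLoopDeg ends x) : Bundle.HasBundle ends o a₁ a₂ a₃ b := by
  obtain ⟨eA, hA, eB, hB, e₃, h3, hAB, hA3, hB3⟩ :=
    Finset.two_lt_card.1 (show 2 < (edgesAt ends x).card from hdeg)
  have htouch : ∀ e ∈ edgesAt ends x, e ∈ touches ends {x, y} := by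
    intro e he
    obtain ⟨hxe, _⟩ := mem_edgesAt.1 he
    obtain ⟨z, hz⟩ := Sym2.mem_iff_exists.1 hxe
    exact ⟨x, by simp, z, hz⟩
  have hin : ∀ z : V, z = x ∨ z = y → z ∈ ({x, y} : Set V) := by
    rintro z (rfl | rfl) <;> simp
  refine ⟨{x, y}, v, ⟨?_, ?_, ?_, ?_⟩, ?_, hv1, hv2, eA, eB, e₃, hAB, hA3, hB3, htouch eA hA,
    htouch eB hB, htouch e₃ h3, (mem_edgesAt.1 hA).2, (mem_edgesAt.1 hB).2, (mem_edgesAt.1 h3).2⟩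
  · simp only [Set.mem_insert_iff, Set.mem_singleton_iff, not_or]
    exact ⟨hx.2.1.symm, hy.2.1.symm⟩
  · simp only [Set.mem_insert_iff, Set.mem_singleton_iff, not_or]
    exact ⟨hx.2.2.1.symm, hy.2.2.1.symm⟩
  · simp only [Set.mem_insert_iff, Set.mem_singleton_iff, not_or]
    exact ⟨hvx, hvy⟩
  · intro e he z w hzw
    obtain ⟨t, ht, t', ht'⟩ := he
    have htm : t = x ∨ t = y := by simpa using ht
    by_cases hd : (ends e).IsDiag
    · -- a loop at `t ∈ W`
      rw [hzw, Sym2.mk_isDiag_iff] at hd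
      subst hd
      have htz : t ∈ s(z, z) := by rw [← hzw, ht']; simp
      rw [Sym2.mem_iff, or_self] at htz
      subst htz
      exact ⟨Or.inl (hin t htm), Or.inl (hin t htm)⟩
    · -- a non-loop edge at `t`: its other end is in `{x, y, a₁, a₂, v}`
      have hte : e ∈ edgesAt ends t := mem_edgesAt.2 ⟨by rw [ht']; simp, hd⟩
      have hte' : e ∈ edgesAt ends x ∨ e ∈ edgesAt ends y := by
        rcases htm with rfl | rfl
        · exact Or.inl hte
        · exact Or.inr hte
      have htzw : t ∈ s(z, w) := by rw [← hzw, ht']; simp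
      rw [Sym2.mem_iff] at htzw
      rcases htzw with rfl | rfl
      · have hw := hP e hte' t w hzw htm
        refine ⟨Or.inl (hin t htm), ?_⟩
        rcases hw with rfl | rfl | rfl | rfl | rfl <;> simp
      · have hz := hP e hte' t z (by rw [hzw, Sym2.eq_swap]) htm
        refine ⟨?_, Or.inl (hin t htm)⟩
        rcases hz with rfl | rfl | rfl | rfl | rfl <;> simp
  · intro z hz
    rcases (by simpa using hz : z = x ∨ z = y) with rfl | rfl
    · exact hx
    · exact hy

/-- **On the class of record two distinct unmarked vertices, one of them active, reach two
distinct vertices outside themselves and the roots**: non-loop edges `e = {x or y, z}`,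
`f = {x or y, w}` with `z ≠ w`, `z, w ∉ {x, y, a₁, a₂}`. -/
theorem exists_two_outer_nbrs_of_pair {ends : E → Sym2 V} {o a₁ a₂ a₃ b x y : V}
    (h : WReducedMinHAZB ends o a₁ a₂ a₃ b)
    (h12 : a₁ ≠ a₂) (h13 : a₁ ≠ a₃) (h23 : a₂ ≠ a₃) (ho1 : o ≠ a₁) (ho2 : o ≠ a₂) (ho3 : o ≠ a₃)
    (hob : o ≠ b) (hb1 : b ≠ a₁) (hb2 : b ≠ a₂) (hb3 : b ≠ a₃)
    (hx : Unmarked o a₁ a₂ a₃ b x) (hy : Unmarked o a₁ a₂ a₃ b y) (hxy : x ≠ y)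
    (hact : ∃ e, x ∈ ends e ∧ ¬ (ends e).IsDiag) :
    ∃ (e f : E) (z w : V), (ends e = s(x, z) ∨ ends e = s(y, z)) ∧
      (ends f = s(x, w) ∨ ends f = s(y, w)) ∧ z ≠ w ∧
      z ≠ x ∧ z ≠ y ∧ z ≠ a₁ ∧ z ≠ a₂ ∧ w ≠ x ∧ w ≠ y ∧ w ≠ a₁ ∧ w ≠ a₂ := by
  -- the degree of `x` is at least three
  have hdeg : 3 ≤ nonLoopDeg ends x := by
    have hs := (shape_of_wredMinHAZH (wredMinHAZH_of_wredMinHAZB h) h12 h13 h23 ho1 ho2 ho3 hob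
      hb1 hb2 hb3).1.2.1 x hx
    rcases hs with h0 | h3
    · exfalso
      obtain ⟨e, hxe, hd⟩ := hact
      have : e ∈ edgesAt ends x := mem_edgesAt.2 ⟨hxe, hd⟩
      have : 0 < nonLoopDeg ends x := Finset.card_pos.2 ⟨e, this⟩
      omega
    · exact h3
  -- an outer neighbour: the other end of a non-loop edge at `x` or `y`, outside `{x, y, a₁, a₂}`
  let Outer : V → Prop := fun z => ∃ e, (ends e = s(x, z) ∨ ends e = s(y, z)) ∧ z ≠ x ∧ z ≠ y ∧
    z ≠ a₁ ∧ z ≠ a₂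
  -- if all outer neighbours equal one vertex `v`, the pair is a bundle
  have hbundle : ∀ v, v ≠ x → v ≠ y → v ≠ a₁ → v ≠ a₂ → (∀ z, Outer z → z = v) →
      Bundle.HasBundle ends o a₁ a₂ a₃ b := by
    intro v hvx hvy hv1 hv2 hall
    refine hasBundle_of_pair hx hy hvx hvy hv1 hv2 (fun e he z w hzw hz => ?_) hdeg
    by_cases hwx : w = x
    · exact Or.inl hwx
    by_cases hwy : w = y
    · exact Or.inr (Or.inl hwy)
    by_cases hw1 : w = a₁
    · exact Or.inr (Or.inr (Or.inl hw1))
    by_cases hw2 : w = a₂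
    · exact Or.inr (Or.inr (Or.inr (Or.inl hw2)))
    refine Or.inr (Or.inr (Or.inr (Or.inr (hall w ⟨e, ?_, hwx, hwy, hw1, hw2⟩))))
    rcases hz with rfl | rfl
    · exact Or.inl hzw
    · exact Or.inr hzw
  by_cases hz : ∃ z, Outer z
  · obtain ⟨z, e, hez, hzx, hzy, hz1, hz2⟩ := hz
    by_cases hw : ∃ w, Outer w ∧ w ≠ z
    · obtain ⟨w, ⟨f, hfw, hwx, hwy, hw1, hw2⟩, hwz⟩ := hw
      exact ⟨e, f, z, w, hez, hfw, hwz.symm, hzx, hzy, hz1, hz2, hwx, hwy, hw1, hw2⟩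
    · exfalso
      push Not at hw
      exact h.noBundle (hbundle z hzx hzy hz1 hz2 fun w hw' => hw w hw')
  · -- no outer neighbour at all: the bundle with `v = a₃`
    exfalso
    push Not at hz
    exact h.noBundle (hbundle a₃ hx.2.2.2.1.symm hy.2.2.2.1.symm h13.symm h23.symm
      fun w hw' => absurd hw' (hz w))

end Pair

end WRed

end Summit.Ventures.PercRepro2
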